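import Literature.Geometry.DiscreteGeometry.KissingPatterns
import Literature.Geometry.DiscreteGeometry.KissingNumberThree
import HarnessLib

/-!
# Twelve kissing balls touch each other at most 24 times; only the (twisted) cuboctahedron attains it

Cite item `wi-11630` (route AtomisticToContinuum/LinkCensus, items `SoftFourRings`
`stmt-AtomisticToContinuum-3514` and `SoftLayerPropagation` `stmt-AtomisticToContinuum-3513` — their
`η = 0` case — and card `flatley-theil-conjecture-two-sphere-sdp`). ONE named fact (`def … : Prop`,
D-0014), over the vocabulary of `KissingPatterns.lean` (unit-DIAMETER balls: the neighbours of the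
ball at the origin are UNIT vectors; `fccKissingPattern` = the cuboctahedron `(±1, ±1, 0)/√2, …`,
`hcpKissingPattern` = the anticuboctahedron / twisted cuboctahedron; both are twelve unit vectors
with pairwise distances `≥ 1` and `24` unit bonds,
`Literature.Barriers.AtomisticToContinuum.card_contactPairs_fcc/hcp = 48` ordered pairs).

## Source, as printed (primary read)

L. Flatley, A. Tarasov, M. Taylor, F. Theil, *Packing twelve spherical caps to maximize tangencies*,
J. Comput. Appl. Math. 254 (2013) 220–225 [FlatleyEtAl2013]. PRIMARY READ as the authors'
manuscript "Packing Twelve Spherical Caps to Maximize Tangencies", byline L. Flatley, M. Taylor,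
F. Theil, A. Tarasov, dated October 24, 2012, 7 pp. (lit store `paper:url-03986d1e30be`, Wayback
copy of `maths.warwick.ac.uk/~theil/SphericalCaps.pdf`, sha256 `12fb90ff…c85ec`); page and item
numbers below are those of that manuscript (the journal pagination was not seen: acq-01550).
Verbatim:

* Definition 1 (p. 2): "A set `X ⊂ ℝ³` is regular if `|x − y| ≥ 1` for all `x, y ∈ X` such that
  `x ≠ y`. For `x ∈ X` the set of nearest neighbors be given by `N(x) := {y ∈ X : |x − y| = 1}`."
* Definition 3 (p. 3): "A cuboctahedron is the convex hull of the midpoints of the twelve edges of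
  a cube with sidelength 1. A twisted cuboctahedron is obtained on rotating an upper hemisphere of
  a cuboctahedron, `Q`, by an angle of `π/3`, about the center of `Q` and parallel to an equator
  of `Q`, where an equator of `Q` is any regular hexagon of vertices of `Q`." [sic: for vertices
  on the unit sphere `S²` with unit edges the cube has sidelength `√2` — edge midpoints
  `(±1, ±1, 0)/√2, …`, i.e. exactly the tree's `fccKissingPattern`; the rotated-hemisphere solid
  is the anticuboctahedron, the tree's `hcpKissingPattern`.]
* **Theorem 4** (p. 3): "Let `X ⊂ S²` be a regular set such that `#X ≤ 12`. Then the maximal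
  number of pairs `{x, y} ⊂ X` such that `|x − y| = 1` is equal to 24 i.e.
  `♯{{x, y} ⊂ X : |x − y| = 1} ≤ 24`. (3) Equality is only attained when `#X = 12` and the
  points of `X` are placed at the vertices of a cuboctahedron or a twisted cuboctahedron."
  (`S²` = the unit sphere of `ℝ³`; p. 1: "replace each outer sphere with its point of contact with
  the central sphere to create a spherical code of twelve points on `S²`, in which any two
  distinct points are separated by at least a distance 1 … The problem then asks for the maximum
  number of edges of length 1 in this spherical code.")
* Method (computer-assisted), §4 pp. 5–7: "It can be assumed wlog that `CG(X)` is 2-connected"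
  (one sentence, no proof printed); `A₀` = "all 2-connected planar graphs with 12 vertices, at
  least 24 edges and at most 5 edges adjacent to any given vertex … contains 1,430,651 graphs"
  (plantri); Lemma 6 / (8)–(16): linear constraints on the face angles (`τ = arccos (1/3)`),
  decided by a phase-1 simplex — Lemma 8: "67 graphs with 12 vertices for which the absolute
  value of the optimal value is less than `1/1000`" (a floating-point tolerance; no exact or
  interval certificate is printed); §4.3: coordinates computed for the 67, all eliminated but the
  cuboctahedron and the twisted cuboctahedron.
* Also printed (p. 3), NOT vendored here (an open problem as printed, restated open as
  Flatley–Theil 2015 Conj. 2.2): "Conjecture 2. Let the set `X` be regular. If `y ∈ N(x)` and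
  `#N(x) = #N(y) = 12` then `#(N(x) ∩ N(y)) ≥ 4`."

Secondary (restatement, read earlier; arXiv text pp. 9–10): L. Flatley, F. Theil, *Face-centered
cubic crystallization of atomistic configurations*, ARMA 218 (2015) = arXiv:1407.0692
[FlatleyTheil2015], §3.1.1 ("`Cub := 𝓛_fcc ∩ S` and `TCub := 𝓛_hcp ∩ S` … twelve vertices,
twenty-four edges and fourteen faces … `TCub` is in fact a cuboctahedron in which a triangular
face is rotated by an angle of `π/3`"), Definition 3.2 (contact graph `CG(Z)`: edges `{z₁, z₂}`
with `|z₁ − z₂| = 1`), Theorem 3.4 (`|Z| ≤ 12`) and **Theorem 3.5** ("Proof. See [HarTayThe]"):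
"Let `Z ⊂ S` be a discrete set of vertices such that `|z′ − z| ≥ 1` for all `{z, z′} ⊂ Z`. Then
the maximal number of undirected edges in the contact graph `CG(Z)` is `24`. Equality is attained
only when the points of `Z` are placed at the vertices of a cuboctahedron or a twisted
cuboctahedron, with edges of unit length." The restatement drops the primary's hypothesis
`#X ≤ 12` (it is Theorem 3.4 there, the kissing number).

## Rendering

`Z : Finset (EuclideanSpace ℝ (Fin 3))` of unit vectors with pairwise distances `≥ 1`; NO
cardinality hypothesis is carried, because `#Z ≤ 12` is the kissing number theorem, a theorem of
this tree (`musin2006_kissing_three`, proved as `musin2006_kissing_three_holds` in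
`KissingNumberThreeProofs.lean`): the rendering is EQUIVALENT to Theorem 4 with its printed
hypothesis `#X ≤ 12` and its printed equality clause "`#X = 12` and …" —
`FlatleyEtAl2013_maxContacts.iff_card_le_twelve_form` below (proved, from the kissing bound).
Edges of `CG(Z)` are counted as ORDERED pairs at distance exactly `1` (`48 = 2 · 24`, the tree's
convention `((Z ×ˢ Z).filter (dist · · = 1)).card`, cf. `card_contactPairs_fcc`), with the
`DecidablePred` instance universally quantified (as in the tree's counting lemmas) so that any
instance may be used. The equality clause: a cuboctahedron / twisted cuboctahedron with unit
edges and all twelve vertices on `S²` has circumradius `1 = ` edge length, hence is centred at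
the origin, hence is the image of `fccKissingPattern` / `hcpKissingPattern` under a linear
isometry of `ℝ³` (`E →ₗᵢ[ℝ] E`, `E = EuclideanSpace ℝ (Fin 3)`, i.e. `O(3)`; both patterns are
mirror-symmetric, so `O(3)`- and `SO(3)`-orbits agree) — the form the consumers use. Only the
printed direction of the equality clause is asserted ("Equality is only attained when"); that
the two patterns DO have `24` bonds is the tree's `card_contactPairs_fcc/hcp`. Proved
consequences: `.card_eq_twelve` (an extremal `Z` has twelve points), `.shellCloseTo` (the
`η = 0` closeness `ShellCloseTo 0 Z P` of `KissingPatterns.lean`), `.iff_card_le_twelve_form`.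

Not here: the robust form (Flatley–Theil 2015, Prop. 3.3: `α`-bonds, by compactness, no rate) — a
separate statement (it is what `SoftFourRings` asserts with `ε, η`); Conjecture 2 (open).

## References

* [FlatleyEtAl2013] L. Flatley, A. Tarasov, M. Taylor, F. Theil, J. Comput. Appl. Math. 254
  (2013) 220–225, doi:10.1016/j.cam.2013.03.036 — read as the authors' manuscript of
  2012-10-24 (lit `paper:url-03986d1e30be`): Definition 1 (p. 2), Definition 3, Theorem 4 (p. 3),
  Lemma 6 (p. 4), §4 and Lemma 8 (pp. 5–7). Journal pagination not seen (acq-01550).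
* [FlatleyTheil2015] L. Flatley, F. Theil, ARMA 218 (2015) 363–416 = arXiv:1407.0692, §3.1.1,
  Def. 3.2, Thm. 3.4, Thm. 3.5 (arXiv pp. 9–10; held, read).
* [Musin2005] O. R. Musin, *The kissing problem in three dimensions*, Discrete Comput. Geom. 35
  (2006) 375–384: `k(3) = 12` (tree: `musin2006_kissing_three`, `KissingNumberThree.lean`).
-/

noncomputable section

namespace Literature.Geometry.DiscreteGeometry

open Finset

/-- **Flatley–Tarasov–Taylor–Theil 2013, Theorem 4: twelve kissing balls touch each other at most
`24` times, with equality only for the (twisted) cuboctahedron.** As printed (authors' manuscript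
of 2012-10-24, p. 3): "Let `X ⊂ S²` be a regular set such that `#X ≤ 12`. Then the maximal number
of pairs `{x, y} ⊂ X` such that `|x − y| = 1` is equal to 24 i.e.
`♯{{x, y} ⊂ X : |x − y| = 1} ≤ 24`. Equality is only attained when `#X = 12` and the points of
`X` are placed at the vertices of a cuboctahedron or a twisted cuboctahedron" ("regular":
`|x − y| ≥ 1` for `x ≠ y`, Definition 1; `S²` the unit sphere; restated as Flatley–Theil 2015,
Thm. 3.5). Rendered with `Z` a finite set of unit vectors of `ℝ³` with pairwise distances `≥ 1`
(the printed `#X ≤ 12` is then automatic — the kissing number, `musin2006_kissing_three`; see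
`FlatleyEtAl2013_maxContacts.iff_card_le_twelve_form`), edges counted as ORDERED contact pairs
(`≤ 48 = 2 · 24`), and the extremisers as the images of the tree's `fccKissingPattern`
(cuboctahedron) / `hcpKissingPattern` (twisted cuboctahedron) under a linear isometry of `ℝ³` (a
unit-edge (twisted) cuboctahedron inscribed in `S²` is centred at `0`). Computer-assisted in print
(plantri enumeration of 1,430,651 planar graphs, linear programming, coordinates).
[cite: FlatleyEtAl2013, Theorem 4 (authors' manuscript 2012-10-24, p. 3)]
[cite: FlatleyTheil2015, Thm. 3.5 (restatement, arXiv p. 10)] -/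
def FlatleyEtAl2013_maxContacts : Prop :=
  ∀ (Z : Finset (EuclideanSpace ℝ (Fin 3)))
    [DecidablePred fun p : EuclideanSpace ℝ (Fin 3) × EuclideanSpace ℝ (Fin 3) => dist p.1 p.2 = 1],
    (∀ z ∈ Z, ‖z‖ = 1) → (∀ z ∈ Z, ∀ w ∈ Z, z ≠ w → 1 ≤ dist z w) →
      ((Z ×ˢ Z).filter (fun p => dist p.1 p.2 = 1)).card ≤ 48 ∧
        (((Z ×ˢ Z).filter (fun p => dist p.1 p.2 = 1)).card = 48 →
          ∃ A : EuclideanSpace ℝ (Fin 3) →ₗᵢ[ℝ] EuclideanSpace ℝ (Fin 3),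
            Z = fccKissingPattern.image A ∨ Z = hcpKissingPattern.image A)

namespace FlatleyEtAl2013_maxContacts

/-- An extremal kissing arrangement (`24` bonds) consists of exactly twelve balls (it is a
(twisted) cuboctahedron; linear isometries are injective).
[cite: FlatleyTheil2015, Thm. 3.5 and §3.1.1 ("twelve vertices, twenty-four edges")] -/
theorem card_eq_twelve (h : FlatleyEtAl2013_maxContacts) (Z : Finset (EuclideanSpace ℝ (Fin 3)))
    [DecidablePred fun p : EuclideanSpace ℝ (Fin 3) × EuclideanSpace ℝ (Fin 3) => dist p.1 p.2 = 1]
    (h1 : ∀ z ∈ Z, ‖z‖ = 1) (h2 : ∀ z ∈ Z, ∀ w ∈ Z, z ≠ w → 1 ≤ dist z w)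
    (h48 : ((Z ×ˢ Z).filter (fun p => dist p.1 p.2 = 1)).card = 48) : Z.card = 12 := by
  obtain ⟨A, hA⟩ := (h Z h1 h2).2 h48
  rcases hA with rfl | rfl
  · rw [card_image_of_injective _ A.injective, card_fccKissingPattern]
  · rw [card_image_of_injective _ A.injective, card_hcpKissingPattern]

/-- The `η = 0` closeness form used by route AtomisticToContinuum: an extremal kissing arrangement
is `0`-close (tree predicate `ShellCloseTo`) to the FCC or to the HCP pattern.
[cite: FlatleyTheil2015, Thm. 3.5] -/
theorem shellCloseTo (h : FlatleyEtAl2013_maxContacts) (Z : Finset (EuclideanSpace ℝ (Fin 3)))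
    [DecidablePred fun p : EuclideanSpace ℝ (Fin 3) × EuclideanSpace ℝ (Fin 3) => dist p.1 p.2 = 1]
    (h1 : ∀ z ∈ Z, ‖z‖ = 1) (h2 : ∀ z ∈ Z, ∀ w ∈ Z, z ≠ w → 1 ≤ dist z w)
    (h48 : ((Z ×ˢ Z).filter (fun p => dist p.1 p.2 = 1)).card = 48) :
    ShellCloseTo 0 Z fccKissingPattern ∨ ShellCloseTo 0 Z hcpKissingPattern := by
  obtain ⟨A, hA⟩ := (h Z h1 h2).2 h48
  rcases hA with rfl | rfl
  · exact Or.inl ⟨A, EtaMatched.refl le_rfl _⟩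
  · exact Or.inr ⟨A, EtaMatched.refl le_rfl _⟩

end FlatleyEtAl2013_maxContacts

/-! ## The soft-contact counting convention of route TwoCentreKissing at `η = 0`

Route AtomisticToContinuum/TwoCentreKissing (items `RobustTangencyBound`
`stmt-AtomisticToContinuum-3376`, `GapFreeShellRigidity` `stmt-AtomisticToContinuum-3372`; cite item
`wi-11405`, a second request for this same fact) counts contacts as `Nat.card` of the subtype of
ORDERED pairs of DISTINCT points of `T` at distance `≤ 1 + η`. At `η = 0` and for `1`-separated `T`
this is the number of ordered pairs at distance exactly `1`, so the named fact above answers that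
request verbatim; the two lemmas below do the bookkeeping once. -/

namespace FlatleyEtAl2013_maxContacts

/-- Counting conventions agree: for a finite `1`-separated `T ⊂ ℝ³`, the number of ordered pairs of
distinct points of `T` at distance `≤ 1` (`Nat.card` of a subtype of `T × T`, the `η = 0` soft-contact
count of route TwoCentreKissing) is the number of ordered pairs at distance exactly `1`. [folklore] -/
theorem natCard_ne_dist_le_one_eq_card_filter (T : Finset (EuclideanSpace ℝ (Fin 3)))
    [DecidablePred fun p : EuclideanSpace ℝ (Fin 3) × EuclideanSpace ℝ (Fin 3) => dist p.1 p.2 = 1]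
    (h2 : ∀ z ∈ T, ∀ w ∈ T, z ≠ w → 1 ≤ dist z w) :
    Nat.card {q : ↥T × ↥T // q.1 ≠ q.2 ∧ dist (q.1 : EuclideanSpace ℝ (Fin 3)) q.2 ≤ 1} =
      ((T ×ˢ T).filter (fun p => dist p.1 p.2 = 1)).card := by
  rw [← Nat.card_eq_finsetCard]
  refine Nat.card_congr
    { toFun := fun q => ⟨((q.1.1 : EuclideanSpace ℝ (Fin 3)), (q.1.2 : EuclideanSpace ℝ (Fin 3))),
        mem_filter.2 ⟨mem_product.2 ⟨q.1.1.2, q.1.2.2⟩, le_antisymm q.2.2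
          (h2 _ q.1.1.2 _ q.1.2.2 fun h => q.2.1 (Subtype.ext h))⟩⟩
      invFun := fun p =>
        ⟨(⟨p.1.1, (mem_product.1 (mem_filter.1 p.2).1).1⟩, ⟨p.1.2, (mem_product.1 (mem_filter.1 p.2).1).2⟩),
          fun h => by
            have h1 : dist p.1.1 p.1.2 = 1 := (mem_filter.1 p.2).2
            rw [show p.1.1 = p.1.2 from congrArg Subtype.val h, dist_self] at h1
            exact zero_ne_one h1,
          (mem_filter.1 p.2).2.le⟩
      left_inv := fun q => rfl
      right_inv := fun p => rfl }

/-- **The fact in the counting convention of route TwoCentreKissing (`η = 0`).** A finite set of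
unit vectors of `ℝ³` with pairwise distances `≥ 1` and at least `48` ordered pairs of distinct points
at distance `≤ 1` is, after a linear isometry, exactly (`ShellCloseTo 0`) the FCC or the HCP kissing
pattern — the `η = 0` instance of the route's `RobustTangencyBound`, from
`FlatleyEtAl2013_maxContacts` (at most `48`, hence exactly `48`, then the equality clause).
[cite: FlatleyTheil2015, Thm. 3.5] -/
theorem shellCloseTo_of_natCard (h : FlatleyEtAl2013_maxContacts)
    (T : Finset (EuclideanSpace ℝ (Fin 3))) (h1 : ∀ z ∈ T, ‖z‖ = 1)
    (h2 : ∀ z ∈ T, ∀ w ∈ T, z ≠ w → 1 ≤ dist z w)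
    (h48 : 48 ≤ Nat.card {q : ↥T × ↥T // q.1 ≠ q.2 ∧ dist (q.1 : EuclideanSpace ℝ (Fin 3)) q.2 ≤ 1}) :
    ShellCloseTo 0 T fccKissingPattern ∨ ShellCloseTo 0 T hcpKissingPattern := by
  classical
  rw [natCard_ne_dist_le_one_eq_card_filter T h2] at h48
  exact shellCloseTo h T h1 h2 (le_antisymm (h T h1 h2).1 h48)

/-- In the same convention: such a set has exactly twelve points and exactly `48` ordered contact
pairs. [cite: FlatleyTheil2015, Thm. 3.5] -/
theorem card_eq_twelve_of_natCard (h : FlatleyEtAl2013_maxContacts)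
    (T : Finset (EuclideanSpace ℝ (Fin 3))) (h1 : ∀ z ∈ T, ‖z‖ = 1)
    (h2 : ∀ z ∈ T, ∀ w ∈ T, z ≠ w → 1 ≤ dist z w)
    (h48 : 48 ≤ Nat.card {q : ↥T × ↥T // q.1 ≠ q.2 ∧ dist (q.1 : EuclideanSpace ℝ (Fin 3)) q.2 ≤ 1}) :
    T.card = 12 ∧
      Nat.card {q : ↥T × ↥T // q.1 ≠ q.2 ∧ dist (q.1 : EuclideanSpace ℝ (Fin 3)) q.2 ≤ 1} = 48 := by
  classical
  rw [natCard_ne_dist_le_one_eq_card_filter T h2] at h48 ⊢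
  have h48' : ((T ×ˢ T).filter (fun p => dist p.1 p.2 = 1)).card = 48 :=
    le_antisymm (h T h1 h2).1 h48
  exact ⟨card_eq_twelve h T h1 h2 h48', h48'⟩

end FlatleyEtAl2013_maxContacts

/-! ## Theorem 4 with its printed cardinality hypothesis

The primary prints Theorem 4 for regular `X ⊂ S²` "such that `#X ≤ 12`", with the equality clause
"only attained when `#X = 12` and …". The named fact above carries no cardinality hypothesis; the
two forms are equivalent because a set of unit vectors of `ℝ³` with pairwise distances `≥ 1` has at
most twelve elements — the kissing number, the tree's `musin2006_kissing_three` (proved in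
`KissingNumberThreeProofs.lean` as `musin2006_kissing_three_holds`; taken here as a hypothesis so
that this file stays light). -/

namespace FlatleyEtAl2013_maxContacts

/-- **Faithfulness to the printed hypotheses.** Given the kissing bound `k(3) ≤ 12`
(`musin2006_kissing_three`), the tree's rendering `FlatleyEtAl2013_maxContacts` is equivalent to
Theorem 4 exactly as printed: for regular `X ⊂ S²` WITH `#X ≤ 12`, at most `24` unit pairs
(`48` ordered), and equality only when `#X = 12` and `X` is a (twisted) cuboctahedron.
[cite: FlatleyEtAl2013, Theorem 4 (authors' manuscript 2012-10-24, p. 3)]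
[cite: Musin2005, p. 4 Theorem (k(3) = 12)] -/
theorem iff_card_le_twelve_form (hk : musin2006_kissing_three) :
    FlatleyEtAl2013_maxContacts ↔
      ∀ (Z : Finset (EuclideanSpace ℝ (Fin 3)))
        [DecidablePred fun p : EuclideanSpace ℝ (Fin 3) × EuclideanSpace ℝ (Fin 3) => dist p.1 p.2 = 1],
        (∀ z ∈ Z, ‖z‖ = 1) → (∀ z ∈ Z, ∀ w ∈ Z, z ≠ w → 1 ≤ dist z w) → Z.card ≤ 12 →
          ((Z ×ˢ Z).filter (fun p => dist p.1 p.2 = 1)).card ≤ 48 ∧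
            (((Z ×ˢ Z).filter (fun p => dist p.1 p.2 = 1)).card = 48 →
              Z.card = 12 ∧
                ∃ A : EuclideanSpace ℝ (Fin 3) →ₗᵢ[ℝ] EuclideanSpace ℝ (Fin 3),
                  Z = fccKissingPattern.image A ∨ Z = hcpKissingPattern.image A) := by
  constructor
  · intro h Z _ h1 h2 _
    exact ⟨(h Z h1 h2).1, fun h48 => ⟨card_eq_twelve h Z h1 h2 h48, (h Z h1 h2).2 h48⟩⟩
  · intro h Z _ h1 h2
    have h12 : Z.card ≤ 12 := hk Z h1 h2
    exact ⟨(h Z h1 h2 h12).1, fun h48 => ((h Z h1 h2 h12).2 h48).2⟩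

end FlatleyEtAl2013_maxContacts

end Literature.Geometry.DiscreteGeometry

end
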